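import Summits.BirchSwinnertonDyer.BirchSwinnertonDyer.Theorems.PrintCFramBottomClassIndexLawFiveLeHeegnerFieldSupplySeedOn
import HarnessLib

/-!
# Crux `PrintCFram.BottomClassIndexLawFiveLe` (stmt-BirchSwinnertonDyer-20372), line `eisenstein-resource-bdp-line` (registry v26 → v27):
# THE FLIPPED-CUSP RUNG AT THE LEVEL PRIMES — `stub_seedOffExc` ⟸ (FlipRung⁶) ∧ (SeedOffExcBad⁶)
# (cell `bsd-print-cfram`, LEAD g14 `bsd-line-cfram-p1`; THEOREMS ONLY, `--supports` 20372; BSD is not proved by any of this)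

HONEST FRAMING. Nothing here is a statement about BSD; no registered stub is closed by this file alone. Registry v26's analytic research
residue `stub_seedOffExc` (for a REGULAR class datum `(p, m, χ, k)` OFF the locus `L(m,p)` whose `m` has a prime `ℓ ≡ ±1 (mod p)`, SOME
`m`-admissible imaginary quadratic `K₀` — every `q ∣ m` split, `d_{K₀}` odd `< −4` — has a unit field factor `‖k⁻¹B_{k,(χ↑ε₀↑)~}‖_p = 1`) is
derived here from TWO hypotheses:

* **(FlipRung⁶)** `hFlip` — THE FLIPPED-CUSP RUNG, in Bernoulli currency (PRINT-DERIVABLE, typing owed). For a class datum, a sign pattern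
  `τ` on the odd primes of `m` (values `±1`), and an odd prime `q ∣ m` with `q* := (−1/q)·q ≢ 1 (mod p)`: if the field factor is a NON-unit at
  EVERY imaginary quadratic `K₀` with `d_{K₀}` odd, `< −4`, `3 ∤ d_{K₀}`, `J(d_{K₀} | q') = τ(q')` for every odd prime `q' ∣ m`, and
  `d_{K₀} ≡ 1 (mod 8)` if `2 ∣ m`, then the same holds for the pattern FLIPPED at `q`. MECHANISM (crux notes lead-g14 §2, numerically
  certified there): the `τ`-cut of Cohen's `H_k` (Cohen 1975 Thm 3.1; cut = translate-average, Shimura 1973 §1) read at the cusp `W_{q⁴}(∞)`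
  has, at the frequencies `q·u`, the coefficients `(1/2q)·(1 + σ q (−u/q))·H(k, ·)` of BOTH Legendre classes at `q` (weights `1 ± q*`); Katz's
  q-expansion principle (Katz 1973 Cor. 1.6.2) transports «≡ 0 (mod p)» from `∞` to that cusp; `1 − q*` is a `p`-unit by hypothesis.
* **(SeedOffExcBad⁶)** `hBad` — THE THIN RESEARCH RESIDUE: `stub_seedOffExc`'s text with the extra hypothesis «some prime `q ∣ m` has
  `q ≡ −1 (mod 4p)`, or `2 ∣ m` and `p ≢ 7 (mod 8)`». At a prime `q ≡ −1 (mod 4p)` (a level-raising prime inert in `ℚ(√−p)` with `q ≡ 3 (mod 4)`)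
  no cusp sees the Legendre class of the reading index `n = m·p` (lead-g14 §2.4); the `2`-adic clause awaits the `2`-adic rung.

THE COMPOSITION (`seedOffExc_of_flipRung_of_bad`, §3): off the bad cases, assume no admissible unit seed; flip, one prime at a time, the
class at every odd `q ∣ m` inert in `ℚ(√−p)` (each has `q* ≢ 1 (mod p)`: `q ≡ 1 (mod p)` forces `(−p/q) = +1`, and `q ≡ −1 (mod p)` with
`q ≡ 3 (mod 4)` is the excluded bad case — §1); the flipped pattern is that of `K₀ = ℚ(√−p)` itself, whose field factor is the REFLECTED class
factor (§2, the CM reflection `(1/k)B_{k,χ·(·/p)} ≡ (1/(p−k))B_{p−k,χ}` of `…HeegnerFieldSupplyReflection`, as in w8 g5's `seedOn_six`) — a unit by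
regularity: contradiction. beyond-print theorem: NO (the rung is print-derivable; the residue is research). BSD is not proved by any of this.

References: [Cohen1975] Thm. 3.1; [Shimura1973] Prop. 1.3–1.5; [Katz1973] Cor. 1.6.2; [Washington1997] Thm. 5.11, Cor. 5.13; [KrizLi2019]
Thm. 1.20, §8; [IrelandRosen1990] Prop. 5.2.2; crux notes `Lines/eisenstein-resource-bdp-line-lead-g14.md` §2.
-/

set_option autoImplicit false
-- summit-side namespace `Summit.BirchSwinnertonDyer.BirchSwinnertonDyer.…` (single-conjunct summit, D-0017 layout)
set_option linter.dupNamespace false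

noncomputable section

open scoped Classical NumberTheorySymbols
open NumberField DirichletCharacter Literature.NumberTheory.LFunctions
  Literature.NumberTheory.EllipticCurves Literature.NumberTheory.EllipticCurves.KrizLi2019
  Literature.NumberTheory.Congruences Literature.NumberTheory.QuadraticFields

namespace Summit.BirchSwinnertonDyer.BirchSwinnertonDyer.Theorems.PrintCFram.FlipRung

open Summit.BirchSwinnertonDyer.BirchSwinnertonDyer.Theorems.PrintCFram
open Summit.BirchSwinnertonDyer.BirchSwinnertonDyer.Theorems.PrintCFram.HeegnerFieldSupply
open Summit.BirchSwinnertonDyer.BirchSwinnertonDyer.Theorems.PrintCFram.KummerDictionary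
open Summit.BirchSwinnertonDyer.Rank1Residual Summit.BirchSwinnertonDyer.Rank1Residual.X12.O11

variable {p : ℕ} [hp : Fact p.Prime]

/-! ## §1 The flippable primes: an odd `q` inert in `ℚ(√−p)` has `q* ≢ 1 (mod p)` unless `q ≡ −1 (mod 4p)` -/

omit hp in
/-- **`J(−p | q) = −1` and `p ∣ q·J(−1 | q) − 1` force `q ≡ −1 (mod 4p)`** (`p` an odd prime, `q` an odd prime). If `q ≡ 1 (mod 4)` then
`J(−1 | q) = 1`, so `q ≡ 1 (mod p)`, and reciprocity gives `J(−p | q) = J(p | q) = J(q | p) = J(1 | p) = 1`, a contradiction; if `q ≡ 3 (mod 4)`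
then `J(−1 | q) = −1`, so `p ∣ q + 1`, and with `4 ∣ q + 1` this is `q ≡ −1 (mod 4p)`. [cite: IrelandRosen1990, Prop. 5.2.2 and Thm. 5.2.1] -/
theorem mod_four_mul_eq_of_jacobiSym_neg_eq_neg_one_of_dvd {p q : ℕ} (hp : p.Prime) (hp2 : p ≠ 2) (hq : q.Prime) (hq2 : q ≠ 2)
    (hoff : jacobiSym (-(p : ℤ)) q = -1) (hstar : (p : ℤ) ∣ (q : ℤ) * jacobiSym (-1) q - 1) :
    q % (4 * p) = 4 * p - 1 := by
  have hqodd : Odd q := hq.eq_two_or_odd'.resolve_left hq2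
  have hpodd : Odd p := hp.eq_two_or_odd'.resolve_left hp2
  have hneg : jacobiSym (-(p : ℤ)) q = ZMod.χ₄ q * jacobiSym (p : ℤ) q := jacobiSym.neg _ hqodd
  rcases Nat.odd_mod_four_iff.mp (Nat.odd_iff.mp hqodd) with h1 | h3
  · exfalso
    have hχ : ZMod.χ₄ q = 1 := ZMod.χ₄_nat_one_mod_four h1
    rw [jacobiSym.at_neg_one hqodd, hχ, mul_one] at hstar
    have hmod : (q : ℤ) % p = 1 % p := (Int.modEq_iff_dvd.mpr hstar).symm
    have hrec : jacobiSym (p : ℤ) q = jacobiSym (q : ℤ) p := jacobiSym.quadratic_reciprocity_one_mod_four' hpodd h1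
    have hJq : jacobiSym (q : ℤ) p = 1 := by
      rw [jacobiSym.mod_left, hmod, ← jacobiSym.mod_left, jacobiSym.one_left]
    rw [hneg, hχ, one_mul, hrec, hJq] at hoff
    norm_num at hoff
  · have hχ : ZMod.χ₄ q = -1 := ZMod.χ₄_nat_three_mod_four h3
    rw [jacobiSym.at_neg_one hqodd, hχ] at hstar
    have hq1 : (p : ℤ) ∣ ((q + 1 : ℕ) : ℤ) := by
      have e : (q : ℤ) * -1 - 1 = -(((q + 1 : ℕ) : ℤ)) := by push_cast; ring
      rw [e] at hstar
      exact dvd_neg.mp hstar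
    have hq1' : p ∣ q + 1 := by exact_mod_cast hq1
    have h4 : 4 ∣ q + 1 := by omega
    have hcop : Nat.Coprime 4 p := by
      have h2p : Nat.Coprime 2 p := (Nat.coprime_primes Nat.prime_two hp).mpr (Ne.symm hp2)
      simpa using (Nat.Coprime.pow_left 2 h2p)
    have h4p : 4 * p ∣ q + 1 := Nat.Coprime.mul_dvd_of_dvd_of_dvd hcop h4 hq1'
    obtain ⟨c, hc⟩ := h4p
    have hp1 := hp.two_le
    have hc1 : 1 ≤ c := by
      rcases Nat.eq_zero_or_pos c with h0 | h0
      · subst h0; omega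
      · exact h0
    have hq' : q = 4 * p * (c - 1) + (4 * p - 1) := by
      have h' : 4 * p * c = 4 * p * (c - 1) + 4 * p := by
        rcases c with _ | c
        · omega
        · simp [Nat.mul_succ]
      omega
    rw [hq', Nat.mul_add_mod]
    exact Nat.mod_eq_of_lt (by omega)

/-! ## §2 The CM field `ℚ(√−p)` as a reading point: its field factor is the reflected class factor (w8 g5's `seedOn_six`, locus-free) -/

/-- **The field `K₀ = ℚ(√−p)` and its Kronecker character, with the REFLECTION of the field factor onto the class factor** (the locus-free core
of w8 g5's `seedOn_six`): for `p ∈ {7, 11, 19, 43, 67, 163}`, `m ⊥ p`, `χ` primitive mod `m`, `k ∈ {(p+1)/4, (3p−1)/4}`, there are an imaginary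
quadratic `K₀` with `d_{K₀} = −p` and a Kronecker character `ε₀` of `K₀` such that a NON-unit field factor `‖k⁻¹B_{k,(χ↑ε₀↑)~}‖_p ≤ p⁻¹` forces a
NON-unit class factor `‖(p−k)⁻¹B_{p−k,χ}‖_p ≤ p⁻¹` (CM reflection `(1/k)B_{k,χ·(·/p)} ≡ (1/(p−k))B_{p−k,χ} (mod p)`; `(χ↑ε₀↑)~ = χ↑(ω^{(p−1)/2})↑` on `ℕ`).
[cite: Washington1997, Thm. 5.11 and Cor. 5.13] [cite: Cox2013, §1.C Lemma 1.14] -/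
theorem exists_cmField_fieldFactor_le_imp (hp6 : p = 7 ∨ p = 11 ∨ p = 19 ∨ p = 43 ∨ p = 67 ∨ p = 163) (m : ℕ) [NeZero m]
    (χ : DirichletCharacter ℚ_[p] m) (k : ℕ) (hmp : m.Coprime p) (hχ : χ.IsPrimitive)
    (hk : k = (p + 1) / 4 ∨ k = (3 * p - 1) / 4) :
    ∃ (K₀ : Type) (_ : Field K₀) (_ : NumberField K₀) (ε₀ : DirichletCharacter ℚ_[p] (NumberField.discr K₀).natAbs),
      IsImaginaryQuadratic K₀ ∧ NumberField.discr K₀ = -(p : ℤ) ∧ IsKroneckerCharacterOf K₀ ε₀ ∧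
      (‖(k : ℚ_[p])⁻¹ * @generalizedBernoulli ℚ_[p] _ _
            (changeLevel (dvd_mul_right m (NumberField.discr K₀).natAbs) χ *
              changeLevel (dvd_mul_left (NumberField.discr K₀).natAbs m) ε₀).conductor ⟨conductor_ne_zero _⟩ k
            (changeLevel (dvd_mul_right m (NumberField.discr K₀).natAbs) χ *
              changeLevel (dvd_mul_left (NumberField.discr K₀).natAbs m) ε₀).primitiveCharacter‖ ≤ (p : ℝ)⁻¹ →
        ‖((p - k : ℕ) : ℚ_[p])⁻¹ * generalizedBernoulli (p - k) χ‖ ≤ (p : ℝ)⁻¹) := by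
  have hpp := hp.out
  have hp3 : p % 4 = 3 := by rcases hp6 with h | h | h | h | h | h <;> subst h <;> norm_num
  have h7 : 7 ≤ p := by rcases hp6 with h | h | h | h | h | h <;> omega
  have hp2 : p ≠ 2 := by omega
  -- the field `K₀ = ℚ(√−p)`
  have hsqZ : Squarefree (-(p : ℤ)) := by
    rw [← Int.squarefree_natAbs]
    simpa using hpp.squarefree
  obtain ⟨K₀, iF, iN, h2, hd⟩ := Quadratic.exists_numberField_discr_eq (D := -(p : ℤ))
    (Or.inl ⟨by omega, hsqZ, by omega⟩)
  have hK₀ : IsImaginaryQuadratic K₀ := isImaginaryQuadratic_of_discr_eq_of_neg h2 hd (by omega)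
  have hdn : (NumberField.discr K₀).natAbs = p := by rw [hd]; simp
  -- its Kronecker character `J(· | p)` and a Teichmüller character
  obtain ⟨ε₀, hε₀, hε₀v⟩ :=
    KrizLiBinders.exists_isKroneckerCharacterOf_of_discr (p := p) h2 (m := p) hpp.squarefree (Or.inr ⟨hd, hp3⟩)
  obtain ⟨ω, hω⟩ := exists_isTeichmullerCharacter (p := p)
  have hh : (p - 1) / 2 ≠ 0 := by omega
  refine ⟨K₀, iF, iN, ε₀, hK₀, hd, hε₀, ?_⟩
  -- the field factor at `K₀` is the reflected class factor
  set Ψ : DirichletCharacter ℚ_[p] (m * (NumberField.discr K₀).natAbs) :=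
    changeLevel (dvd_mul_right m (NumberField.discr K₀).natAbs) χ *
      changeLevel (dvd_mul_left (NumberField.discr K₀).natAbs m) ε₀ with hΨ
  have hcχ : χ.conductor = m := hχ
  have hcε : ε₀.conductor = (NumberField.discr K₀).natAbs := hε₀.1
  have hcond : Ψ.conductor = m * p := by
    rw [hΨ, RouteU.conductor_changeLevel_mul_changeLevel _ _ χ ε₀ (by rw [hcχ, hcε, hdn]; exact hmp),
      hcχ, hcε, hdn]
  have hΨprim : Ψ.IsPrimitive := by
    rw [isPrimitive_def, hcond, hdn]
  have hval : ∀ a : ℕ, Ψ.primitiveCharacter (a : ZMod Ψ.conductor) =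
      (changeLevel (dvd_mul_right m p) χ * changeLevel (dvd_mul_left p m) (ω ^ ((p - 1) / 2)) :
        DirichletCharacter ℚ_[p] (m * p)) (a : ZMod (m * p)) := by
    intro a
    rw [primitiveCharacter_apply_natCast_of_isPrimitive Ψ hΨprim a, hΨ,
      CharacterTwist.changeLevel_mul_changeLevel_apply_natCast χ ε₀ a, thetaShape_apply_natCast χ ω hh a,
      hε₀v a, jacobiSym_eq_teichmuller_pow_half hω hp2 a]
  have hB : @generalizedBernoulli ℚ_[p] _ _ Ψ.conductor ⟨conductor_ne_zero _⟩ k Ψ.primitiveCharacter =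
      generalizedBernoulli k (changeLevel (dvd_mul_right m p) χ *
        changeLevel (dvd_mul_left p m) (ω ^ ((p - 1) / 2))) := by
    haveI : NeZero Ψ.conductor := ⟨conductor_ne_zero _⟩
    exact generalizedBernoulli_eq_of_forall_apply_natCast_eq hcond _ _ hval k
  intro hle
  rw [hB] at hle
  exact (norm_div_generalizedBernoulli_legendreTwist_le_inv_iff hp3 h7 hmp χ hω hk).mp hle

/-! ## §3 `stub_seedOffExc` ⟸ (FlipRung⁶) ∧ (SeedOffExcBad⁶) -/

/-- **Registry v26's `stub_seedOffExc` (VERBATIM) ⟸ (FlipRung⁶) ∧ (SeedOffExcBad⁶).** `hFlip` = THE FLIPPED-CUSP RUNG in Bernoulli currency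
(module docstring; print-derivable: Cohen 1975 Thm 3.1, Shimura 1973 Prop. 1.3–1.5, Katz 1973 Cor. 1.6.2, plus the finite Fourier lemma of
crux notes lead-g14 §2.1; typing owed), `hBad` = `stub_seedOffExc`'s text restricted to the classes with a prime `q ∣ m`, `q ≡ −1 (mod 4p)`, or with
`2 ∣ m` and `p ≢ 7 (mod 8)` (research). PROOF: off the bad cases, if no `m`-admissible `K₀` (every `q ∣ m` split, `d_{K₀}` odd `< −4`) had a unit
field factor, then every `K₀` of the all-split pattern with `3 ∤ d_{K₀}` has a non-unit one; flipping (by `hFlip`) one at a time the odd primes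
`q ∣ m` inert in `ℚ(√−p)` — each flippable by §1, the bad residue `q ≡ −1 (mod 4p)` being excluded — reaches the pattern `q ↦ J(−p | q)` of
`ℚ(√−p)` itself (`d = −p`: odd, `< −4`, prime to `3`, `≡ 1 (mod 8)` when `2 ∣ m` because then `p ≡ 7 (mod 8)`), where the field factor is the
reflected class factor (§2) — a unit by regularity: contradiction. Nothing about BSD. [cite: Cohen1975, Thm. 3.1] [cite: Katz1973, Cor. 1.6.2]
[cite: Washington1997, Thm. 5.11] [cite: KrizLi2019, §8 (pp. 49–52)] -/
theorem seedOffExc_of_flipRung_of_bad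
    (hFlip : ∀ (p : ℕ) [Fact p.Prime] (m : ℕ) [NeZero m] (χ : DirichletCharacter ℚ_[p] m) (k : ℕ),
      (p = 7 ∨ p = 11 ∨ p = 19 ∨ p = 43 ∨ p = 67 ∨ p = 163) →
      m.Coprime p → χ.IsPrimitive → χ.IsQuadratic → (k = (p + 1) / 4 ∨ k = (3 * p - 1) / 4) →
      2 ≤ k → k ≤ p - 2 → χ (-1) * (-1) ^ k = -1 →
      ∀ (τ : ℕ → ℤ) (q : ℕ), q.Prime → q ∣ m → q ≠ 2 →
      (∀ q' : ℕ, q'.Prime → q' ∣ m → q' ≠ 2 → (τ q' = 1 ∨ τ q' = -1)) →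
      ¬ ((p : ℤ) ∣ (q : ℤ) * jacobiSym (-1) q - 1) →
      (∀ (K₀ : Type) [Field K₀] [NumberField K₀] (ε₀ : DirichletCharacter ℚ_[p] (NumberField.discr K₀).natAbs),
        IsImaginaryQuadratic K₀ → Odd (NumberField.discr K₀) → NumberField.discr K₀ < -4 →
        ¬ ((3 : ℤ) ∣ NumberField.discr K₀) →
        (∀ q' : ℕ, q'.Prime → q' ∣ m → q' ≠ 2 → jacobiSym (NumberField.discr K₀) q' = τ q') →
        (2 ∣ m → NumberField.discr K₀ % 8 = 1) → IsKroneckerCharacterOf K₀ ε₀ →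
        ‖(k : ℚ_[p])⁻¹ * @generalizedBernoulli ℚ_[p] _ _
            (changeLevel (dvd_mul_right m (NumberField.discr K₀).natAbs) χ *
              changeLevel (dvd_mul_left (NumberField.discr K₀).natAbs m) ε₀).conductor ⟨conductor_ne_zero _⟩ k
            (changeLevel (dvd_mul_right m (NumberField.discr K₀).natAbs) χ *
              changeLevel (dvd_mul_left (NumberField.discr K₀).natAbs m) ε₀).primitiveCharacter‖ ≤ (p : ℝ)⁻¹) →
      ∀ (K₀ : Type) [Field K₀] [NumberField K₀] (ε₀ : DirichletCharacter ℚ_[p] (NumberField.discr K₀).natAbs),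
        IsImaginaryQuadratic K₀ → Odd (NumberField.discr K₀) → NumberField.discr K₀ < -4 →
        ¬ ((3 : ℤ) ∣ NumberField.discr K₀) →
        (∀ q' : ℕ, q'.Prime → q' ∣ m → q' ≠ 2 → jacobiSym (NumberField.discr K₀) q' = (if q' = q then -τ q' else τ q')) →
        (2 ∣ m → NumberField.discr K₀ % 8 = 1) → IsKroneckerCharacterOf K₀ ε₀ →
        ‖(k : ℚ_[p])⁻¹ * @generalizedBernoulli ℚ_[p] _ _
            (changeLevel (dvd_mul_right m (NumberField.discr K₀).natAbs) χ *
              changeLevel (dvd_mul_left (NumberField.discr K₀).natAbs m) ε₀).conductor ⟨conductor_ne_zero _⟩ k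
            (changeLevel (dvd_mul_right m (NumberField.discr K₀).natAbs) χ *
              changeLevel (dvd_mul_left (NumberField.discr K₀).natAbs m) ε₀).primitiveCharacter‖ ≤ (p : ℝ)⁻¹)
    (hBad : ∀ (p : ℕ) [Fact p.Prime] (m : ℕ) [NeZero m] (χ : DirichletCharacter ℚ_[p] m) (k : ℕ),
      (p = 7 ∨ p = 11 ∨ p = 19 ∨ p = 43 ∨ p = 67 ∨ p = 163) →
      m.Coprime p → χ.IsPrimitive → χ.IsQuadratic → (k = (p + 1) / 4 ∨ k = (3 * p - 1) / 4) →
      2 ≤ k → k ≤ p - 2 → χ (-1) * (-1) ^ k = -1 →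
      ¬ ((∀ q : ℕ, q.Prime → q ∣ m → q ≠ 2 → jacobiSym (-(p : ℤ)) q = 1) ∧ (2 ∣ m → p % 8 = 7)) →
      (∃ ℓ : ℕ, ℓ.Prime ∧ ℓ ∣ m ∧ (ℓ % p = 1 ∨ ℓ % p = p - 1)) →
      ((∃ q : ℕ, q.Prime ∧ q ∣ m ∧ q % (4 * p) = 4 * p - 1) ∨ (2 ∣ m ∧ p % 8 ≠ 7)) →
      ¬ ‖((p - k : ℕ) : ℚ_[p])⁻¹ * generalizedBernoulli (p - k) χ‖ ≤ (p : ℝ)⁻¹ →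
      ∃ (K₀ : Type) (_ : Field K₀) (_ : NumberField K₀) (ε₀ : DirichletCharacter ℚ_[p] (NumberField.discr K₀).natAbs),
        IsImaginaryQuadratic K₀ ∧
        (∀ q : ℕ, q.Prime → q ∣ m → ((Ideal.span {(q : ℤ)}).primesOver (𝓞 K₀)).ncard = 2) ∧
        Odd (NumberField.discr K₀) ∧ NumberField.discr K₀ < -4 ∧ IsKroneckerCharacterOf K₀ ε₀ ∧
        ¬ ‖(k : ℚ_[p])⁻¹ * @generalizedBernoulli ℚ_[p] _ _
            (changeLevel (dvd_mul_right m (NumberField.discr K₀).natAbs) χ *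
              changeLevel (dvd_mul_left (NumberField.discr K₀).natAbs m) ε₀).conductor ⟨conductor_ne_zero _⟩ k
            (changeLevel (dvd_mul_right m (NumberField.discr K₀).natAbs) χ *
              changeLevel (dvd_mul_left (NumberField.discr K₀).natAbs m) ε₀).primitiveCharacter‖ ≤ (p : ℝ)⁻¹) :
    ∀ (p : ℕ) [Fact p.Prime] (m : ℕ) [NeZero m] (χ : DirichletCharacter ℚ_[p] m) (k : ℕ),
      (p = 7 ∨ p = 11 ∨ p = 19 ∨ p = 43 ∨ p = 67 ∨ p = 163) →
      m.Coprime p → χ.IsPrimitive → χ.IsQuadratic → (k = (p + 1) / 4 ∨ k = (3 * p - 1) / 4) →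
      2 ≤ k → k ≤ p - 2 → χ (-1) * (-1) ^ k = -1 →
      ¬ ((∀ q : ℕ, q.Prime → q ∣ m → q ≠ 2 → jacobiSym (-(p : ℤ)) q = 1) ∧ (2 ∣ m → p % 8 = 7)) →
      (∃ ℓ : ℕ, ℓ.Prime ∧ ℓ ∣ m ∧ (ℓ % p = 1 ∨ ℓ % p = p - 1)) →
      ¬ ‖((p - k : ℕ) : ℚ_[p])⁻¹ * generalizedBernoulli (p - k) χ‖ ≤ (p : ℝ)⁻¹ →
      ∃ (K₀ : Type) (_ : Field K₀) (_ : NumberField K₀) (ε₀ : DirichletCharacter ℚ_[p] (NumberField.discr K₀).natAbs),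
        IsImaginaryQuadratic K₀ ∧
        (∀ q : ℕ, q.Prime → q ∣ m → ((Ideal.span {(q : ℤ)}).primesOver (𝓞 K₀)).ncard = 2) ∧
        Odd (NumberField.discr K₀) ∧ NumberField.discr K₀ < -4 ∧ IsKroneckerCharacterOf K₀ ε₀ ∧
        ¬ ‖(k : ℚ_[p])⁻¹ * @generalizedBernoulli ℚ_[p] _ _
            (changeLevel (dvd_mul_right m (NumberField.discr K₀).natAbs) χ *
              changeLevel (dvd_mul_left (NumberField.discr K₀).natAbs m) ε₀).conductor ⟨conductor_ne_zero _⟩ k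
            (changeLevel (dvd_mul_right m (NumberField.discr K₀).natAbs) χ *
              changeLevel (dvd_mul_left (NumberField.discr K₀).natAbs m) ε₀).primitiveCharacter‖ ≤ (p : ℝ)⁻¹ := by
  intro p _ m _ χ k hp6 hmp hχ hχq hk hk2 hkp hpar hoff hexc hreg
  by_cases hb : (∃ q : ℕ, q.Prime ∧ q ∣ m ∧ q % (4 * p) = 4 * p - 1) ∨ (2 ∣ m ∧ p % 8 ≠ 7)
  · exact hBad p m χ k hp6 hmp hχ hχq hk hk2 hkp hpar hoff hexc hb hreg
  have hnb : ∀ q : ℕ, ¬ (q.Prime ∧ q ∣ m ∧ q % (4 * p) = 4 * p - 1) := fun q h => hb (Or.inl ⟨q, h⟩)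
  have hn2 : 2 ∣ m → p % 8 = 7 := fun h2 => by
    by_contra h8
    exact hb (Or.inr ⟨h2, h8⟩)
  have hpp : p.Prime := Fact.out
  have hp3 : p % 4 = 3 := by rcases hp6 with h | h | h | h | h | h <;> subst h <;> norm_num
  have h7 : 7 ≤ p := by rcases hp6 with h | h | h | h | h | h <;> omega
  have hp2 : p ≠ 2 := by omega
  have hm0 : m ≠ 0 := NeZero.ne m
  by_contra H
  -- Step 1: the all-split pattern carries no unit (restricted to `3 ∤ d`)
  have hV1 : ∀ (K₀ : Type) [Field K₀] [NumberField K₀] (ε₀ : DirichletCharacter ℚ_[p] (NumberField.discr K₀).natAbs),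
      IsImaginaryQuadratic K₀ → Odd (NumberField.discr K₀) → NumberField.discr K₀ < -4 →
      ¬ ((3 : ℤ) ∣ NumberField.discr K₀) →
      (∀ q' : ℕ, q'.Prime → q' ∣ m → q' ≠ 2 → jacobiSym (NumberField.discr K₀) q' = (fun _ : ℕ => (1 : ℤ)) q') →
      (2 ∣ m → NumberField.discr K₀ % 8 = 1) → IsKroneckerCharacterOf K₀ ε₀ →
      ‖(k : ℚ_[p])⁻¹ * @generalizedBernoulli ℚ_[p] _ _
            (changeLevel (dvd_mul_right m (NumberField.discr K₀).natAbs) χ *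
              changeLevel (dvd_mul_left (NumberField.discr K₀).natAbs m) ε₀).conductor ⟨conductor_ne_zero _⟩ k
            (changeLevel (dvd_mul_right m (NumberField.discr K₀).natAbs) χ *
              changeLevel (dvd_mul_left (NumberField.discr K₀).natAbs m) ε₀).primitiveCharacter‖ ≤ (p : ℝ)⁻¹ := by
    intro K₀ _ _ ε₀ hK hodd hlt _h3 hpat h8 hε
    by_contra hunit
    apply H
    refine ⟨K₀, inferInstance, inferInstance, ε₀, hK, ?_, hodd, hlt, hε, hunit⟩
    intro q hq hqm
    by_cases hq2 : q = 2
    · subst hq2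
      have h := (Quadratic.ncard_primesOver_two_eq_two_iff hK.1).mpr (h8 hqm)
      simpa using h
    · rw [Quadratic.ncard_primesOver_eq_two_iff_jacobiSym hK.1 hq hq2]
      exact hpat q hq hqm hq2
  -- Step 2: flip, one prime at a time, every odd `q ∣ m` inert in `ℚ(√−p)`
  set Qoff : Finset ℕ := m.primeFactors.filter (fun q => q ≠ 2 ∧ jacobiSym (-(p : ℤ)) q = -1) with hQoff
  have hstep : ∀ S : Finset ℕ, S ⊆ Qoff →
      ∀ (K₀ : Type) [Field K₀] [NumberField K₀] (ε₀ : DirichletCharacter ℚ_[p] (NumberField.discr K₀).natAbs),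
      IsImaginaryQuadratic K₀ → Odd (NumberField.discr K₀) → NumberField.discr K₀ < -4 →
      ¬ ((3 : ℤ) ∣ NumberField.discr K₀) →
      (∀ q' : ℕ, q'.Prime → q' ∣ m → q' ≠ 2 →
        jacobiSym (NumberField.discr K₀) q' = (fun x : ℕ => if x ∈ S then (-1 : ℤ) else 1) q') →
      (2 ∣ m → NumberField.discr K₀ % 8 = 1) → IsKroneckerCharacterOf K₀ ε₀ →
      ‖(k : ℚ_[p])⁻¹ * @generalizedBernoulli ℚ_[p] _ _
            (changeLevel (dvd_mul_right m (NumberField.discr K₀).natAbs) χ *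
              changeLevel (dvd_mul_left (NumberField.discr K₀).natAbs m) ε₀).conductor ⟨conductor_ne_zero _⟩ k
            (changeLevel (dvd_mul_right m (NumberField.discr K₀).natAbs) χ *
              changeLevel (dvd_mul_left (NumberField.discr K₀).natAbs m) ε₀).primitiveCharacter‖ ≤ (p : ℝ)⁻¹ := by
    intro S
    induction S using Finset.induction_on with
    | empty =>
      intro _ K₀ _ _ ε₀ hK hodd hlt h3 hpat h8 hε
      exact hV1 K₀ ε₀ hK hodd hlt h3 (fun q' hq' hq'm hq'2 => by simpa using hpat q' hq' hq'm hq'2) h8 hε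
    | @insert q S hqS ih =>
      intro hsub
      have hqQ : q ∈ Qoff := hsub (Finset.mem_insert_self q S)
      have hS : S ⊆ Qoff := fun x hx => hsub (Finset.mem_insert_of_mem hx)
      have hqQ' : q ∈ m.primeFactors ∧ q ≠ 2 ∧ jacobiSym (-(p : ℤ)) q = -1 := by
        simpa [hQoff, Finset.mem_filter] using hqQ
      obtain ⟨hqpf, hq2, hJq⟩ := hqQ'
      have hq : q.Prime := Nat.prime_of_mem_primeFactors hqpf
      have hqm : q ∣ m := Nat.dvd_of_mem_primeFactors hqpf
      have hstar : ¬ ((p : ℤ) ∣ (q : ℤ) * jacobiSym (-1) q - 1) := fun h =>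
        hnb q ⟨hq, hqm, mod_four_mul_eq_of_jacobiSym_neg_eq_neg_one_of_dvd hpp hp2 hq hq2 hJq h⟩
      have hτ : ∀ q' : ℕ, q'.Prime → q' ∣ m → q' ≠ 2 →
          ((fun x : ℕ => if x ∈ S then (-1 : ℤ) else 1) q' = 1 ∨ (fun x : ℕ => if x ∈ S then (-1 : ℤ) else 1) q' = -1) := by
        intro q' _ _ _
        by_cases h : q' ∈ S <;> simp [h]
      have hflip := hFlip p m χ k hp6 hmp hχ hχq hk hk2 hkp hpar (fun x : ℕ => if x ∈ S then (-1 : ℤ) else 1) q hq hqm hq2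
        hτ hstar (ih hS)
      intro K₀ _ _ ε₀ hK hodd hlt h3 hpat h8 hε
      refine hflip K₀ ε₀ hK hodd hlt h3 ?_ h8 hε
      intro q' hq' hq'm hq'2
      rw [hpat q' hq' hq'm hq'2]
      by_cases hqq : q' = q
      · subst hqq
        simp [hqS]
      · simp [Finset.mem_insert, hqq]
  have hVQ := hstep Qoff subset_rfl
  -- Step 3: read at `K₀ = ℚ(√−p)`, whose pattern is `q ↦ J(−p | q)` and whose field factor is the reflected class factor
  obtain ⟨K₀, iF, iN, ε₀, hK, hd, hε, himp⟩ := exists_cmField_fieldFactor_le_imp hp6 m χ k hmp hχ hk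
  apply hreg
  apply himp
  refine hVQ K₀ ε₀ hK ?_ ?_ ?_ ?_ ?_ hε
  · rw [hd]
    exact (Int.odd_coe_nat p |>.mpr (hpp.eq_two_or_odd'.resolve_left hp2)).neg
  · rw [hd]
    omega
  · rw [hd, Int.dvd_neg]
    intro h3
    have h3' : 3 ∣ p := by exact_mod_cast h3
    have := (Nat.prime_dvd_prime_iff_eq Nat.prime_three hpp).mp h3'
    omega
  · intro q' hq' hq'm hq'2
    rw [hd]
    have hq'p : q' ≠ p := by
      rintro rfl
      have : Nat.Coprime q' q' := Nat.Coprime.coprime_dvd_left hq'm hmp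
      rw [Nat.coprime_self] at this
      exact hq'.ne_one this
    by_cases hmem : q' ∈ Qoff
    · have hmem' : q' ∈ m.primeFactors ∧ q' ≠ 2 ∧ jacobiSym (-(p : ℤ)) q' = -1 := by
        simpa [hQoff, Finset.mem_filter] using hmem
      simp only [hmem, if_true]
      exact hmem'.2.2
    · simp only [hmem, if_false]
      have hgcd : Int.gcd (-(p : ℤ)) q' = 1 := by
        rw [Int.neg_gcd, Int.gcd_natCast_natCast]
        exact (Nat.coprime_primes hpp hq').mpr (Ne.symm hq'p)
      rcases jacobiSym.eq_one_or_neg_one hgcd with h1 | h1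
      · exact h1
      · exfalso
        apply hmem
        simp only [hQoff, Finset.mem_filter, Nat.mem_primeFactors]
        exact ⟨⟨hq', hq'm, hm0⟩, hq'2, h1⟩
  · intro h2m
    rw [hd]
    have := hn2 h2m
    omega

end Summit.BirchSwinnertonDyer.BirchSwinnertonDyer.Theorems.PrintCFram.FlipRung

end
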